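import Literature.NumberTheory.EllipticCurves.WeierstrassGeometricPlaces
import Literature.NumberTheory.EllipticCurves.IsogenyRamification
import Literature.NumberTheory.DiophantineGeometry.FunctionFieldDivisorsNegativeDegreeProofs
import HarnessLib

/-!
# Orders at geometric points versus orders at places of `k(W)`: `e = 1`, fibre sums, and Abel's
theorem over the base field

Continuation of `WeierstrassGeometricPlaces` (`ι = toGeom W : k(W) → k̄(W)`, `belowPlace`, fibres
= Frobenius orbits over a finite field). For an elliptic curve `W` over a finite field `k`:

* `exists_ord_toGeom_eq_mul`: for every geometric point `R` there is `e ≥ 1` with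
  `ord_R(ι h) = e · ord_{v_R}(h)` for all `h ≠ 0` (`v_R` the place below `R`);
* `finsum_eq_add_sum_sum` (**fibre regrouping**): a finitely supported sum over `E(k̄)` is the term at
  `O` plus, over the places `v` below the support, the sums over the Frobenius orbits
  `σ^j R_v`, `j < deg v`;
* **`ord_toGeom_eq`: `ord_R(ι h) = ord_{v_R}(h)`** — the constant field extension `k̄(W)/k(W)` is
  unramified (Stichtenoth Thm. 3.6.3 (a)), proved by comparing `Σ_R ord_R(ι a) = 0` over `k̄` with
  `deg (a) = 0` over `k` for `a ∈ 𝔭_R ∖ 0`;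
* **`sum_ord_smul_orbitSum_eq_zero`** (Abel's theorem over `k`, Silverman *AEC* III.3.5 ⇒ pushed
  down): `Σ_v ord_v(h) • (Σ_{j < deg v} σ^j R_v) = O` in `E(k̄)` for `h ∈ k(W)^×`.

Everything is proved; no named facts.

## References

* J. H. Silverman, *The Arithmetic of Elliptic Curves*, 2nd ed., GTM 106, II.§1–§2, Cor. III.3.5. [SilvermanAEC2009]
* H. Stichtenoth, *Algebraic Function Fields and Codes*, 2nd ed., GTM 254, Thm. 3.6.3. [Stichtenoth2009]
-/

noncomputable section

open scoped Classical Polynomial.Bivariate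
open Polynomial WeierstrassCurve WeierstrassCurve.Affine
open Literature.NumberTheory.EllipticCurves.WeierstrassFunctionField
open Literature.NumberTheory.DiophantineGeometry Literature.NumberTheory.DiophantineGeometry.AlgFunctionField
open Literature.NumberTheory.EllipticCurves.WeierstrassGeometricPlaces

universe u

namespace Literature.NumberTheory.EllipticCurves.WeierstrassGeometricOrders

variable {F : Type u} [Field F] (W : WeierstrassCurve F) [W.IsElliptic]

/-! ### `ord_R(ι h) = e_R · ord_{v_R}(h)` -/

section Ramification

/-- `ord_R(ι u) = 0` for a unit `u` of the place below `R`. [folklore] -/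
theorem ord_toGeom_eq_zero_of_valuation_eq_one (R : W.geomPoints) {u : W.toAffine.FunctionField}
    (hu : (belowPlace W R).valuation u = 1) :
    ord (W.baseChange (AlgebraicClosure F)).toAffine R (toGeom W u) = 0 := by
  have hu0 : u ≠ 0 := by intro h0; rw [h0, Valuation.map_zero] at hu; exact zero_ne_one hu
  have h1 : u ∈ (belowPlace W R).toValuationSubring :=
    ((belowPlace W R).toValuationSubring.valuation_le_one_iff u).1 hu.le
  have h2 : u⁻¹ ∈ (belowPlace W R).toValuationSubring := by
    rw [← (belowPlace W R).toValuationSubring.valuation_le_one_iff]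
    change (belowPlace W R).valuation u⁻¹ ≤ 1
    rw [map_inv₀, hu, inv_one]
  rw [mem_belowPlace_iff, mem_place_iff] at h1 h2
  rw [map_inv₀, map_inv₀] at h2
  have hne : placeValuation (W.baseChange (AlgebraicClosure F)).toAffine R (toGeom W u) ≠ 0 :=
    placeValuation_ne_zero _ ((_root_.map_ne_zero (toGeom W)).2 hu0)
  have heq : placeValuation (W.baseChange (AlgebraicClosure F)).toAffine R (toGeom W u) = 1 :=
    le_antisymm h1 ((inv_le_one₀ (zero_lt_iff.2 hne)).1 h2)
  have h := placeValuation_eq_exp_neg_ord (V := (W.baseChange (AlgebraicClosure F)).toAffine) R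
    ((_root_.map_ne_zero (toGeom W)).2 hu0)
  rw [heq] at h
  have h' := congrArg WithZero.log h
  rw [WithZero.log_one, WithZero.log_exp] at h'
  omega

omit [W.IsElliptic] in
/-- `ord_P(u^n) = n · ord_P(u)` for all integers `n` (`u ≠ 0`). [folklore] -/
theorem ord_zpow {k : Type u} [Field k] (V : WeierstrassCurve.Affine k) [V.IsElliptic] (P : V.Point)
    {u : V.FunctionField} (hu : u ≠ 0) (n : ℤ) : ord V P (u ^ n) = n * ord V P u := by
  rcases le_or_gt 0 n with h | h
  · obtain ⟨m, rfl⟩ := Int.eq_ofNat_of_zero_le h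
    rw [zpow_natCast, ord_pow P hu]
  · obtain ⟨m, hm⟩ := Int.eq_ofNat_of_zero_le (by omega : 0 ≤ -n)
    rw [show n = -(m : ℤ) by omega, zpow_neg, zpow_natCast, ord_inv, ord_pow P hu]
    ring

/-- **`ord_R(ι h) = e_R · ord_{v_R}(h)`** with `e_R ≥ 1` (the ramification index of `R` over the
place `v_R` below it): `ι` maps a uniformizer `π` of `v_R` to an element of order `e_R ≥ 1` at `R`,
and units of `v_R` to units at `R`. [cite: Stichtenoth2009, Def. 3.1.5] -/
theorem exists_ord_toGeom_eq_mul (R : W.geomPoints) :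
    ∃ e : ℕ, 1 ≤ e ∧ ∀ h : W.toAffine.FunctionField, h ≠ 0 →
      ord (W.baseChange (AlgebraicClosure F)).toAffine R (toGeom W h) = e * (belowPlace W R).ord h := by
  set v := belowPlace W R with hv
  set π : W.toAffine.FunctionField := (v.uniformizer : W.toAffine.FunctionField) with hπ
  have hπ0 : π ≠ 0 := v.coe_uniformizer_ne_zero
  have hπlt : v.valuation π < 1 := v.valuation_uniformizer_lt_one
  have hpos : 0 < ord (W.baseChange (AlgebraicClosure F)).toAffine R (toGeom W π) := by
    rw [← placeValuation_lt_one_iff_ord_pos R ((_root_.map_ne_zero (toGeom W)).2 hπ0),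
      ← valuation_belowPlace_lt_one_iff]
    exact hπlt
  refine ⟨(ord (W.baseChange (AlgebraicClosure F)).toAffine R (toGeom W π)).toNat, by omega,
    fun h hh => ?_⟩
  set n : ℤ := v.ord h with hn
  set u : W.toAffine.FunctionField := h * π ^ (-n) with hu
  have hu1 : v.valuation u = 1 := by
    rw [hu, Valuation.map_mul, map_zpow₀, v.valuation_eq_zpow_ord hh, ← hn, ← hπ,
      ← zpow_add₀ v.valuation_uniformizer_ne_zero, add_neg_cancel, zpow_zero]
  have hu0 : u ≠ 0 := by
    intro h0; rw [h0, Valuation.map_zero] at hu1; exact zero_ne_one hu1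
  have hh' : h = π ^ n * u := by
    rw [hu, mul_left_comm, ← zpow_add₀ hπ0, add_neg_cancel, zpow_zero, mul_one]
  rw [hh', map_mul, ord_mul R ((_root_.map_ne_zero (toGeom W)).2 (zpow_ne_zero n hπ0)) ((_root_.map_ne_zero (toGeom W)).2 hu0),
    map_zpow₀, ord_zpow _ R ((_root_.map_ne_zero (toGeom W)).2 hπ0), ord_toGeom_eq_zero_of_valuation_eq_one W R hu1,
    add_zero, Int.toNat_of_nonneg hpos.le]
  exact mul_comm _ _

end Ramification

/-! ### Fibre sums: regrouping a finite sum over `E(k̄)` by the places below -/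

section FibreSum

variable [Finite F] (σ : Field.absoluteGaloisGroup F) (hσ : ∀ x : AlgebraicClosure F, σ • x = x ^ Nat.card F)

/-- **The Frobenius orbit of a geometric point** as a finite set: `{σ^j R : j < deg v_R}`.
[cite: Stichtenoth2009, Thm. 3.6.3] -/
def orbit (R : W.geomPoints) : Finset W.geomPoints :=
  (Finset.range (belowPlace W R).degree).image fun j => (σ ^ j) • R

omit [Finite F] in
omit [W.IsElliptic] in
/-- `Γ_k`-translates of a nonzero point are nonzero. [folklore] -/
theorem smul_ne_zero_of_ne_zero (τ : Field.absoluteGaloisGroup F) {R : W.geomPoints} (hR : R ≠ 0) : τ • R ≠ 0 :=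
  fun h => hR ((smul_eq_zero_iff_eq τ).1 h)

include hσ in
/-- **Membership in the orbit = lying over the same place** (for `R ≠ O`). [cite: Stichtenoth2009, Thm. 3.6.3] -/
theorem mem_orbit_iff {R : W.geomPoints} (hR : R ≠ 0) (P : W.geomPoints) :
    P ∈ orbit W σ R ↔ belowPlace W P = belowPlace W R := by
  rw [orbit, Finset.mem_image]
  constructor
  · rintro ⟨j, -, rfl⟩
    exact belowPlace_smul W (σ ^ j) R
  · intro h
    obtain ⟨a, b, h', rfl⟩ := geomPoints.exists_eq_some hR
    obtain ⟨j, hj, rfl⟩ := exists_eq_pow_smul W σ hσ h' h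
    exact ⟨j, Finset.mem_range.2 hj, rfl⟩

include hσ in
/-- `j ↦ σ^j R` is injective on `j < deg v_R` (`R ≠ O`). [cite: Stichtenoth2009, Thm. 3.6.3] -/
theorem injOn_range {R : W.geomPoints} (hR : R ≠ 0) :
    Set.InjOn (fun j : ℕ => (σ ^ j) • R) (Finset.range (belowPlace W R).degree : Set ℕ) := by
  obtain ⟨a, b, h', rfl⟩ := geomPoints.exists_eq_some hR
  rw [Finset.coe_range]
  exact pow_smul_injOn W σ hσ h'

include hσ in
/-- **The orbit has `deg v_R` elements.** [cite: Stichtenoth2009, Thm. 3.6.3] -/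
theorem card_orbit {R : W.geomPoints} (hR : R ≠ 0) : (orbit W σ R).card = (belowPlace W R).degree := by
  rw [orbit, Finset.card_image_of_injOn (injOn_range W σ hσ hR), Finset.card_range]

include hσ in
/-- A sum over the orbit is the sum over `j < deg v_R` of the values at `σ^j R`. [folklore] -/
theorem sum_orbit {M : Type*} [AddCommMonoid M] {R : W.geomPoints} (hR : R ≠ 0) (f : W.geomPoints → M) :
    ∑ P ∈ orbit W σ R, f P = ∑ j ∈ Finset.range (belowPlace W R).degree, f ((σ ^ j) • R) := by
  rw [orbit, Finset.sum_image fun i hi j hj h => injOn_range W σ hσ hR hi hj h]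

include hσ in
/-- **Fibre regrouping of a finite sum over `E(k̄)`**: if `f` vanishes off `O` and the points above a
finite set `S` of places, and `pt v ≠ O` is a chosen point above each `v ∈ S`, then
`Σ_R f(R) = f(O) + Σ_{v ∈ S} Σ_{j < deg v} f(σ^j pt_v)`. [cite: Stichtenoth2009, Thm. 3.6.3] -/
theorem finsum_eq_add_sum_sum {M : Type*} [AddCommMonoid M] (f : W.geomPoints → M)
    (S : Finset (PlaceOver F W.toAffine.FunctionField)) (pt : PlaceOver F W.toAffine.FunctionField → W.geomPoints)
    (hpt : ∀ v ∈ S, pt v ≠ 0 ∧ belowPlace W (pt v) = v)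
    (hsupp : ∀ R : W.geomPoints, R ≠ 0 → f R ≠ 0 → belowPlace W R ∈ S) :
    ∑ᶠ R, f R = f 0 + ∑ v ∈ S, ∑ j ∈ Finset.range v.degree, f ((σ ^ j) • pt v) := by
  -- the finite set carrying the support
  set T : Finset W.geomPoints := S.biUnion fun v => orbit W σ (pt v) with hT
  have h0T : (0 : W.geomPoints) ∉ T := by
    rw [hT, Finset.mem_biUnion]
    rintro ⟨v, hv, h0⟩
    rw [orbit, Finset.mem_image] at h0
    obtain ⟨j, -, hj⟩ := h0
    exact smul_ne_zero_of_ne_zero W (σ ^ j) (hpt v hv).1 hj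
  have hsub : Function.support f ⊆ ↑(insert (0 : W.geomPoints) T) := by
    intro R hR
    rw [Function.mem_support] at hR
    rw [Finset.coe_insert, Set.mem_insert_iff]
    rcases eq_or_ne R 0 with rfl | hR0
    · exact Or.inl rfl
    · right
      rw [Finset.mem_coe, hT, Finset.mem_biUnion]
      refine ⟨belowPlace W R, hsupp R hR0 hR, ?_⟩
      rw [mem_orbit_iff W σ hσ (hpt _ (hsupp R hR0 hR)).1, (hpt _ (hsupp R hR0 hR)).2]
  rw [finsum_eq_sum_of_support_subset f hsub, Finset.sum_insert h0T]
  congr 1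
  have hdisj : (S : Set (PlaceOver F W.toAffine.FunctionField)).PairwiseDisjoint fun v => orbit W σ (pt v) := by
    intro v hv w hw hvw
    rw [Function.onFun, Finset.disjoint_left]
    intro P hPv hPw
    rw [mem_orbit_iff W σ hσ (hpt v hv).1, (hpt v hv).2] at hPv
    rw [mem_orbit_iff W σ hσ (hpt w hw).1, (hpt w hw).2] at hPw
    exact hvw (hPv.symm.trans hPw)
  rw [hT, Finset.sum_biUnion hdisj]
  refine Finset.sum_congr rfl fun v hv => ?_
  rw [sum_orbit W σ hσ (hpt v hv).1, (hpt v hv).2]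

end FibreSum

/-! ### `e = 1`: `ord_R(ι h) = ord_{v_R}(h)` -/

section Unramified

/-- The ramification index `e_R ≥ 1` of `exists_ord_toGeom_eq_mul` (a choice). [cite: Stichtenoth2009, Def. 3.1.5] -/
def ramIdx (R : W.geomPoints) : ℕ := Classical.choose (exists_ord_toGeom_eq_mul W R)

/-- `e_R ≥ 1`. [folklore] -/
theorem one_le_ramIdx (R : W.geomPoints) : 1 ≤ ramIdx W R := (Classical.choose_spec (exists_ord_toGeom_eq_mul W R)).1

/-- `ord_R(ι h) = e_R · ord_{v_R}(h)`. [cite: Stichtenoth2009, Def. 3.1.5] -/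
theorem ord_toGeom_eq_ramIdx_mul (R : W.geomPoints) {h : W.toAffine.FunctionField} (hh : h ≠ 0) :
    ord (W.baseChange (AlgebraicClosure F)).toAffine R (toGeom W h) = ramIdx W R * (belowPlace W R).ord h :=
  (Classical.choose_spec (exists_ord_toGeom_eq_mul W R)).2 h hh

omit [W.IsElliptic] in
/-- `ord_∞(x) = -2` in `k(W)`. [cite: SilvermanAEC2009, proof of Prop. III.3.1] -/
theorem ord_infPlace_xF : (WeierstrassPlaceAtInfinity.infPlace W.toAffine).ord (xF W.toAffine) = -2 := by
  have hx : xF W.toAffine ≠ 0 := fun h => (transcendental_xF W.toAffine) (h ▸ isAlgebraic_zero)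
  rw [Literature.NumberTheory.EllipticCurves.WeierstrassPlaceAtInfinity.ord_infPlace_eq_neg_log _ hx,
    show xF W.toAffine = algebraMap F[X] W.toAffine.FunctionField X from rfl,
    WeierstrassPlaceAtInfinity.infValuationF_x, WithZero.log_exp]

/-- **`e_O = 1`**: `ord_O(ι x) = -2 = ord_∞(x)`. [cite: Stichtenoth2009, Thm. 3.6.3] -/
theorem ramIdx_zero : ramIdx W 0 = 1 := by
  have hx : xF W.toAffine ≠ 0 := fun h => (transcendental_xF W.toAffine) (h ▸ isAlgebraic_zero)
  have h := ord_toGeom_eq_ramIdx_mul W 0 hx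
  rw [belowPlace_zero, ord_infPlace_xF, toGeom_xF] at h
  have h0 : ord (W.baseChange (AlgebraicClosure F)).toAffine (0 : W.geomPoints) W.genX = -2 :=
    ord_zero_X (V := (W.baseChange (AlgebraicClosure F)).toAffine)
  rw [h0] at h
  have h1 := one_le_ramIdx W 0
  omega

variable [Finite F] (σ : Field.absoluteGaloisGroup F) (hσ : ∀ x : AlgebraicClosure F, σ • x = x ^ Nat.card F)

include σ hσ in
/-- **The constant field extension `k̄(W)/k(W)` is unramified: `ord_R(ι h) = ord_{v_R}(h)`** for every
geometric point `R` and `h ≠ 0` (Stichtenoth Thm. 3.6.3 (a)). Proof for affine `R`: for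
`0 ≠ a ∈ 𝔭_R`, compare `Σ_{R'} ord_{R'}(ι a) = 0` over `k̄` (fibrewise: `Σ_v deg v · e_v · ord_v(a)`)
with `deg (a) = 0` over `k` (`Σ_v deg v · ord_v(a)`); all `ord_v(a) ≥ 0` at finite `v` and `e_O = 1`,
so `(e_v - 1) ord_v(a) = 0` for all `v`, and `ord_{v_R}(a) ≥ 1`. [cite: Stichtenoth2009, Thm. 3.6.3] -/
theorem ramIdx_eq_one (R : W.geomPoints) : ramIdx W R = 1 := by
  rcases eq_or_ne R 0 with rfl | hR
  · exact ramIdx_zero W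
  obtain ⟨a₀, b₀, h₀, rfl⟩ := geomPoints.exists_eq_some hR
  set R : W.geomPoints := .some a₀ b₀ h₀ with hRdef
  set v₀ := belowPlace W R with hv₀
  -- `0 ≠ a ∈ 𝔭_R`
  obtain ⟨r, hr0, hr⟩ := exists_ne_zero_evalBase_eq_zero W h₀
  set a : W.toAffine.FunctionField := algebraMap W.toAffine.CoordinateRing W.toAffine.FunctionField r with ha
  have ha0 : a ≠ 0 := fun h0 => hr0 (IsFractionRing.injective W.toAffine.CoordinateRing
    W.toAffine.FunctionField (by rw [← ha, h0, map_zero]))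
  -- `ord_v(a) ≥ 0` at finite places, `≥ 1` at `v₀`
  have hnonneg : ∀ v : PlaceOver F W.toAffine.FunctionField,
      v ≠ WeierstrassPlaceAtInfinity.infPlace W.toAffine → 0 ≤ v.ord a := by
    intro v hv
    obtain ⟨P, rfl⟩ := exists_belowPlace_eq W v
    have hP : P ≠ 0 := fun h => hv (by rw [h, belowPlace_zero])
    obtain ⟨a', b', h', rfl⟩ := geomPoints.exists_eq_some hP
    exact PlaceOver.ord_nonneg_of_mem _ (algebraMap_mem_belowPlace W h' r)
  have hpos : 1 ≤ v₀.ord a := by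
    have hlt : v₀.valuation a < 1 := (valuation_algebraMap_lt_one_iff W h₀ r).2 hr
    rw [PlaceOver.valuation_lt_one_iff_le] at hlt
    exact (PlaceOver.valuation_le_zpow_iff_le_ord v₀ ha0 1).1 (by rwa [zpow_one])
  -- the finite set of finite places where `a` has nonzero order
  set S : Finset (PlaceOver F W.toAffine.FunctionField) :=
    ((finite_setOf_ord_ne_zero_of_ne_zero (K := F) ha0).toFinset).erase
      (WeierstrassPlaceAtInfinity.infPlace W.toAffine) with hS
  have hmemS : ∀ v, v ∈ S ↔ v ≠ WeierstrassPlaceAtInfinity.infPlace W.toAffine ∧ v.ord a ≠ 0 := fun v => by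
    rw [hS, Finset.mem_erase, Set.Finite.mem_toFinset]; rfl
  have hv₀S : v₀ ∈ S := (hmemS v₀).2 ⟨belowPlace_ne_infPlace W hR, by omega⟩
  -- chosen points above the places of `S`, with `pt v₀ = R`
  have hex : ∀ v : PlaceOver F W.toAffine.FunctionField, ∃ P : W.geomPoints, belowPlace W P = v :=
    exists_belowPlace_eq W
  set pt : PlaceOver F W.toAffine.FunctionField → W.geomPoints := fun v =>
    if v = v₀ then R else Classical.choose (hex v) with hpt
  have hptv : ∀ v, belowPlace W (pt v) = v := fun v => by
    by_cases h : v = v₀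
    · rw [hpt]; simp only [h, if_true]; rfl
    · rw [hpt]; simp only [h, if_false]; exact Classical.choose_spec (hex v)
  have hpt0 : ∀ v ∈ S, pt v ≠ 0 ∧ belowPlace W (pt v) = v := fun v hv =>
    ⟨fun h0 => ((hmemS v).1 hv).1 (by rw [← hptv v, h0, belowPlace_zero]), hptv v⟩
  have hptv₀ : pt v₀ = R := by rw [hpt]; simp
  -- (1) over `k̄`: `Σ_R ord_R(ι a) = 0`, fibrewise
  have hsum1 := finsum_eq_add_sum_sum W σ hσ
    (fun P => ord (W.baseChange (AlgebraicClosure F)).toAffine P (toGeom W a)) S pt hpt0 (by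
      intro P hP hPa
      rw [hmemS]
      refine ⟨belowPlace_ne_infPlace W hP, fun h0 => hPa ?_⟩
      rw [ord_toGeom_eq_ramIdx_mul W P ha0, h0, mul_zero])
  have hfin : ∑ᶠ P : W.geomPoints, ord (W.baseChange (AlgebraicClosure F)).toAffine P (toGeom W a) = 0 :=
    finsum_ord (V := (W.baseChange (AlgebraicClosure F)).toAffine) ((_root_.map_ne_zero (toGeom W)).2 ha0)
  rw [hfin, ord_toGeom_eq_ramIdx_mul W 0 ha0, ramIdx_zero, Nat.cast_one, one_mul, belowPlace_zero] at hsum1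
  have hinner : ∀ v ∈ S, ∑ j ∈ Finset.range v.degree,
      ord (W.baseChange (AlgebraicClosure F)).toAffine ((σ ^ j) • pt v) (toGeom W a) =
        (v.degree : ℤ) * (ramIdx W (pt v) * v.ord a) := by
    intro v hv
    rw [Finset.sum_congr rfl fun j _ => by rw [ord_smul_toGeom, ord_toGeom_eq_ramIdx_mul W _ ha0, hptv v],
      Finset.sum_const, Finset.card_range, nsmul_eq_mul]
  rw [Finset.sum_congr rfl hinner] at hsum1
  -- (2) over `k`: `deg (a) = 0`
  have hsum2 := degree_principalDivisor_eq_zero (K := F) ha0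
  rw [Divisor.degree_apply, Finsupp.sum_of_support_subset (s := insert (WeierstrassPlaceAtInfinity.infPlace W.toAffine) S)
    _ ?_ _ (fun v _ => by simp)] at hsum2
  swap
  · intro v hv
    rw [Finsupp.mem_support_iff, principalDivisor_apply_of_ne_zero ha0] at hv
    rw [Finset.mem_insert]
    by_cases h : v = WeierstrassPlaceAtInfinity.infPlace W.toAffine
    · exact Or.inl h
    · exact Or.inr ((hmemS v).2 ⟨h, hv⟩)
  have hinf : WeierstrassPlaceAtInfinity.infPlace W.toAffine ∉ S := fun h => ((hmemS _).1 h).1 rfl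
  rw [Finset.sum_insert hinf, principalDivisor_apply_of_ne_zero ha0,
    WeierstrassPlaceAtInfinity.degree_infPlace, Nat.cast_one, mul_one,
    Finset.sum_congr rfl fun v _ => by rw [principalDivisor_apply_of_ne_zero ha0]] at hsum2
  -- subtract: `Σ_{v ∈ S} deg v (e_v - 1) ord_v(a) = 0` with nonnegative terms
  have hdiff : ∑ v ∈ S, (v.degree : ℤ) * ((ramIdx W (pt v) - 1 : ℤ) * v.ord a) = 0 := by
    have e1 : ∑ v ∈ S, (v.degree : ℤ) * ((ramIdx W (pt v) - 1 : ℤ) * v.ord a) =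
        ∑ v ∈ S, (v.degree : ℤ) * (ramIdx W (pt v) * v.ord a) - ∑ v ∈ S, v.ord a * (v.degree : ℤ) := by
      rw [← Finset.sum_sub_distrib]
      refine Finset.sum_congr rfl fun v _ => by ring
    rw [e1]
    linarith
  have hterm : ∀ v ∈ S, 0 ≤ (v.degree : ℤ) * ((ramIdx W (pt v) - 1 : ℤ) * v.ord a) := by
    intro v hv
    have h1 : (1 : ℤ) ≤ ramIdx W (pt v) := by exact_mod_cast one_le_ramIdx W (pt v)
    have h2 : 0 ≤ v.ord a := hnonneg v ((hmemS v).1 hv).1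
    have h3 : (0 : ℤ) ≤ v.degree := by positivity
    exact mul_nonneg h3 (mul_nonneg (by linarith) h2)
  have hzero := (Finset.sum_eq_zero_iff_of_nonneg hterm).1 hdiff v₀ hv₀S
  rw [hptv₀] at hzero
  have hdeg : (1 : ℤ) ≤ v₀.degree := by exact_mod_cast PlaceOver.one_le_degree v₀
  have h1 : (1 : ℤ) ≤ ramIdx W R := by exact_mod_cast one_le_ramIdx W R
  -- `deg v₀ ≥ 1`, `ord_{v₀}(a) ≥ 1`, so `e_R - 1 = 0`
  have : (ramIdx W R : ℤ) - 1 = 0 := by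
    rcases mul_eq_zero.1 hzero with h | h
    · omega
    · rcases mul_eq_zero.1 h with h' | h'
      · exact h'
      · omega
  omega

include σ hσ in
/-- **`ord_R(ι h) = ord_{v_R}(h)`** for every geometric point `R` and `h ≠ 0`.
[cite: Stichtenoth2009, Thm. 3.6.3] -/
theorem ord_toGeom_eq (R : W.geomPoints) {h : W.toAffine.FunctionField} (hh : h ≠ 0) :
    ord (W.baseChange (AlgebraicClosure F)).toAffine R (toGeom W h) = (belowPlace W R).ord h := by
  rw [ord_toGeom_eq_ramIdx_mul W R hh, ramIdx_eq_one W σ hσ R, Nat.cast_one, one_mul]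

end Unramified

/-! ### Abel's theorem pushed down to `k`: `Σ_v ord_v(h) • (Σ_j σ^j R_v) = O` -/

section AbelBase

variable [Finite F] (σ : Field.absoluteGaloisGroup F) (hσ : ∀ x : AlgebraicClosure F, σ • x = x ^ Nat.card F)

/-- **The orbit sum** `Σ_{j < deg v_R} σ^j R ∈ E(k̄)` of a geometric point (the trace of `R` down to
`k`; for `R` above the place `v` this is the `k`-rational point attached to the closed point `v`).
[cite: SilvermanAEC2009, II.§2 and Ex. 2.13] -/
def orbitSum (R : W.geomPoints) : W.geomPoints :=
  ∑ j ∈ Finset.range (belowPlace W R).degree, (σ ^ j) • R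

include hσ in
/-- **Abel's theorem over the base field** (Silverman *AEC* Cor. III.3.5 ⇒, pushed down along the
fibres of `E(k̄) → {places of k(W)}`): for `h ∈ k(W)^×`, any finite set `S` of places containing the
finite places where `h` has a zero or a pole, and chosen points `R_v ≠ O` above the `v ∈ S`,
`Σ_{v ∈ S} ord_v(h) • (Σ_{j < deg v} σ^j R_v) = O` in `E(k̄)` — from `Σ_P ord_P(ι h) • P = O` over `k̄`
(the tree's `WeierstrassCurve.finsum_ord_smul_eq_zero`), `ord_P(ι h) = ord_{v_P}(h)` and the fibre
regrouping. [cite: SilvermanAEC2009, Cor. III.3.5] -/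
theorem sum_ord_smul_orbitSum_eq_zero {h : W.toAffine.FunctionField} (hh : h ≠ 0)
    (S : Finset (PlaceOver F W.toAffine.FunctionField)) (pt : PlaceOver F W.toAffine.FunctionField → W.geomPoints)
    (hpt : ∀ v ∈ S, pt v ≠ 0 ∧ belowPlace W (pt v) = v)
    (hS : ∀ v : PlaceOver F W.toAffine.FunctionField,
      v ≠ WeierstrassPlaceAtInfinity.infPlace W.toAffine → v.ord h ≠ 0 → v ∈ S) :
    ∑ v ∈ S, v.ord h • orbitSum W σ (pt v) = 0 := by
  have habel := WeierstrassCurve.finsum_ord_smul_eq_zero (W := W) ((_root_.map_ne_zero (toGeom W)).2 hh)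
  have hreg := finsum_eq_add_sum_sum W σ hσ
    (fun P : W.geomPoints => ord (W.baseChange (AlgebraicClosure F)).toAffine P (toGeom W h) • P) S pt hpt (by
      intro P hP hPh
      refine hS _ (belowPlace_ne_infPlace W hP) fun h0 => hPh ?_
      change ord (W.baseChange (AlgebraicClosure F)).toAffine P (toGeom W h) • P = 0
      rw [ord_toGeom_eq W σ hσ P hh, h0, zero_smul])
  rw [habel, smul_zero, zero_add] at hreg
  rw [hreg]
  refine Finset.sum_congr rfl fun v hv => ?_
  rw [orbitSum, (hpt v hv).2, Finset.smul_sum]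
  refine Finset.sum_congr rfl fun j _ => ?_
  rw [ord_smul_toGeom, ord_toGeom_eq W σ hσ _ hh, (hpt v hv).2]

end AbelBase

end Literature.NumberTheory.EllipticCurves.WeierstrassGeometricOrders
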